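/-
Copyright (c) 2026. Released under the Apache 2.0 license.
-/
import Literature.NumberTheory.EllipticCurves.IsogenyPotentiallyGoodMinimalDiscriminantProofs
import Literature.NumberTheory.EllipticCurves.LatticeInclusionIsogenyComplexPointsProofs
import Literature.NumberTheory.EllipticCurves.IsogenyNeronScalarPotSupersingular
import HarnessLib

/-!
# The direction of the Néron scaling along an isogeny that moves `ord_p Δ_min`
# (Gealy–Klagsbrun 2017, Prop. 2.1 + Cor. 3.2; Dokchitser–Dokchitser 2015, Table 1) — PROOFS

`Proofs` file (theorems only: no definition, no named fact, no instance), topic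
`NumberTheory/EllipticCurves`; sibling of `IsogenyPotentiallyGoodMinimalDiscriminantProofs.lean`
(Dokchitser–Dokchitser 2015 Thm. 5.1 (1), `p ∤ deg φ ⇒ ord_p Δ_min` unchanged) and of
`NeronIsogenyScalingHoldsProofs.lean` (`exists_int_eq_and_dvd_of_neronScaling`: the Néron scaling
`α` of a rational `p`-isogeny between globally minimal models is `±1` or `±p`, "the printed
theorems decide WHICH").  This file proves, with NO hypothesis on the reduction type beyond
potential good reduction (`0 ≤ ord_p j`), the DIRECTIONAL half of that decision:

* `dvd_neronScaling_of_padicValInt_minimalDiscriminantInt_lt` — `W, W'/ℚ` globally minimal with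
  Néron period pairs `L, L'`, `α ∈ ℤ` with `αΛ_W ⊆ Λ_{W'}` (ANY index), `0 ≤ ord_p j(W)`:
  **if `ord_p Δ_min(W') < ord_p Δ_min(W)` (a `Δ_min`-DROP along `z ↦ αz`) then `p ∣ α`.**
* `dvd_and_not_dvd_neronScaling_of_padicValInt_minimalDiscriminantInt_lt_of_relIndex_eq` — if
  moreover `[Λ_{W'} : αΛ_W] = p` (a `p`-isogeny): a DROP forces `p ∥ α`, a RISE
  (`ord_p Δ_min(W) < ord_p Δ_min(W')`) forces `p ∤ α`.  These are clauses (2) and (3) of the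
  conclusion of the tree's named fact
  `gealyKlagsbrun2017_neronScalar_of_additive_potSupersingular` (Gealy–Klagsbrun 2017, Thm. 1 at
  `K = ℚ_p`), now THEOREMS for every reduction type; what remains of that fact is its clause (1)
  "`ord_p Δ_min(W) ≠ ord_p Δ_min(W')` at an additive potentially supersingular `p`" (the
  inseparability input, op. cit. Prop. 2.6), see
  `gealyKlagsbrun2017_neronScalar_of_additive_potSupersingular_of_ne`.
* by-products: `exists_hasGoodReductionAt_baseChange_of_padicValRat_j_nonneg` (`0 ≤ ord_p j ⇒`
  good reduction at some place above `p` of some number field — Silverman *AEC* VII.5.5 `⇐`, via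
  *ATAEC* IV.10.3 in the tree's form `hasGoodReductionAt_baseChange_of_forall_smul_geomTorsion_…`),
  `padicValRat_j_nonneg_of_isogeny` (potential good reduction at `p` is an isogeny invariant,
  *AEC* VII.7.2), and the one-sided kernel
  `dvd_multiplier_of_padicValInt_minimalDiscriminantInt_lt_of_isMinimalAt`.

## The printed argument (Gealy–Klagsbrun, arXiv:1703.02148, §2–3; held `paper:arxiv-1703.02148`)

For a `p`-isogeny `φ : E → E'` over a `p`-adic field `K` and minimal differentials `ω_K, ω'_K`:
Prop. 2.1 (i) (p. 5; = Dokchitser–Dokchitser, arXiv:1208.5519 Lemma 10 (1), p. 7: "by the Néron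
universal property `φ` extends to a morphism of Néron models", `a = φ^*ω'/ω ∈ 𝒪_K`) says
`val_F(φ^*ω'_F/ω_F) ≥ 0` over EVERY finite `F/K`; Cor. 3.2 (p. 6): over a field `L` where `E`
has good reduction, `ω_L = u·ω_K` with `val_L(u) = e(L/K)·v_min(E/K)/12`; whence the displayed
equation of the proof of Thm. 2 (p. 6, L27–36):
`val_L(φ^*ω'_L/ω_L) = e(L/K)·( val_K(φ^*ω'_K/ω_K) + (v_min(E'/K) − v_min(E/K))/12 )`.
Non-negativity of the left side gives `val_K(φ^*ω'_K/ω_K) ≥ (v_min(E/K) − v_min(E'/K))/12`, so a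
DROP of `v_min` forces `val_K(φ^*ω'_K/ω_K) > 0`; with Prop. 2.1 (ii) (`a·a' = p` for the dual pair,
= Dokchitser–Dokchitser loc. cit. L45 "Because `φᵗφ = [p]`, we have `aa′ = p`") a RISE forces
`val_K(a') > 0` hence `val_K(a) = 0`.  (Gealy–Klagsbrun then add Prop. 2.6 — supersingular `⇒` both
`φ`, `φ'` inseparable mod `𝔭` — to exclude `v_min(E) = v_min(E')`; that step is NOT formalised
here.)  In Dokchitser–Dokchitser's Table 1 (arXiv p. 3, rows `l = p`, column `φ^*ω'/ω`) this is
the rule deciding between "`1` or `p`" whenever `δ ≠ δ'`.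

## The tree's reading (verbatim the one of `IsogenyPotentiallyGoodMinimalDiscriminantProofs`)

`K = ℚ`, Néron differentials = invariant differentials of GLOBALLY MINIMAL models, the isogeny
`z ↦ αz : ℂ/Λ_W → ℂ/Λ_{W'}` of a lattice inclusion `αΛ_W ⊆ Λ_{W'}`
(`exists_isogeny_baseChange_apply_eq_of_forall_mul_mem_lattice`) has `x`-coordinate `A/B` with
`lc A = α⁻²` (`Isogeny.exists_x_formula_of_baseChange_apply_eq`); over the finite Galois
`F = ℚ(W[3])` (`ℚ(W[4])` at `p = 3`) both curves have good reduction at a place `w ∣ p`; for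
`F`-models `C • W_F`, `C' • W'_F` minimal at `w` (unit discriminants, `w(Δ_W) = w(u)¹²`,
`w(Δ_{W'}) = w(u')¹²`) the transported isogeny has multiplier `α u'/u`
(`Isogeny.exists_x_formula_smul_extendScalars`), which is `w`-integral
(`IsDedekindDomain.HeightOneSpectrum.valuation_multiplier_le_one`, the tree's Néron-mapping-property
substitute = Prop. 2.1 (i) over `F`).  Hence `w(α) · w(u') ≤ w(u)`, i.e.
`w(α)¹² · w(p)^{ord_p Δ_min(W')} ≤ w(p)^{ord_p Δ_min(W)}`: if `p ∤ α` then
`ord_p Δ_min(W) ≤ ord_p Δ_min(W')`.  No Néron models, no formal groups, no Tate's algorithm.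

Cell context (why it is wanted; nothing below is claimed to be proved by this file): route
`TameQuarticManinParity` LINE 20 (items U19 `TprimeRedOptimalIsogenyNeronUnit`, F19
`TprimeRedNeronUnitForcesKodairaThree`, F19♭ `TprimeRedKodairaThreeForcesNeronUnit`) reads the
`3`-isogeny edges out of a Kodaira-III curve at `9 ∥ N`: with this file, a III → III* edge has
`3 ∤ α` and a III* → III edge has `3 ∥ α` unconditionally, and the only printed input left on those
items is "no III → III / III* → III* `3`-edges" (clause (1) of the Gealy–Klagsbrun fact at `p = 3`).
BSD is not proved; no leaf, rung or crux is proved by this file.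

## References
* [GealyKlagsbrun2017] M. Gealy, Z. Klagsbrun, *On a local invariant of elliptic curves with a
  `p`-isogeny*, arXiv:1703.02148: Prop. 2.1, Cor. 2.2–2.3, Lemma 3.1, Cor. 3.2, Thm. 1, Thm. 2 and
  its proof (held `paper:arxiv-1703.02148`, pp. 3, 5, 6).
* [DokchitserDokchitser2015LocalInvariants] T. Dokchitser, V. Dokchitser, *Local invariants of
  isogenous elliptic curves*, Trans. AMS 367 (2015) = arXiv:1208.5519: Table 1 (p. 3), §4
  Lemma 10 (1), proof of Lemma 11, Lemma 12 (p. 7).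
* [SilvermanAEC2009] *AEC* VII.5.5 (potential good reduction ⟺ `j` integral), VII.7.2 (isogenous
  curves have good reduction at the same places), VI.4.1(b).
* [SilvermanATAEC1994] *ATAEC* IV.5.1, IV.6.1, Cor. IV.9.1 (Néron mapping property), IV.10.3.
-/

noncomputable section

open scoped Classical

namespace Literature.NumberTheory.EllipticCurves

open _root_.WeierstrassCurve _root_.IsDedekindDomain _root_.NumberField _root_.Polynomial
  ModularForms

/-! ## Valuations at a place above `p` (bookkeeping, as in the sibling file) -/

section Valuation

variable {F : Type} [Field F] [NumberField F]

/-- At a place `w ∣ p`, a nonzero rational `q` with `ord_p q = m ∈ ℕ` has `w(q) = w(p)^m`.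
[folklore] -/
private theorem valuation_ratCast_eq_pow_of_padicValRat_eq_nat (w : HeightOneSpectrum (𝓞 F))
    {p : ℕ} (hp : p.Prime) (hpw : (p : 𝓞 F) ∈ w.asIdeal) {q : ℚ} (hq : q ≠ 0) {m : ℕ}
    (hm : padicValRat p q = m) :
    w.valuation F (q : F) = w.valuation F (p : F) ^ m := by
  haveI := Fact.mk hp
  have hp0 : (p : ℚ) ≠ 0 := by exact_mod_cast hp.ne_zero
  have hq' : padicValRat p (q / (p : ℚ) ^ m) = 0 := by
    rw [padicValRat.div hq (pow_ne_zero _ hp0), padicValRat.pow, padicValRat.self hp.one_lt, hm,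
      mul_one, sub_self]
  have h1 := valuation_ratCast_eq_one_of_padicValRat_eq_zero (v := w) hp hpw
    (div_ne_zero hq (pow_ne_zero _ hp0)) hq'
  have : (q : F) = ((q / (p : ℚ) ^ m : ℚ) : F) * (p : F) ^ m := by
    have hpF0 : (p : F) ≠ 0 := by exact_mod_cast hp.ne_zero
    push_cast
    field_simp
  rw [this, map_mul, h1, one_mul, map_pow]

/-- At a place `w ∣ p`: `0 < w(p) < 1`. [folklore] -/
private theorem valuation_natCast_pos_and_lt_one (w : HeightOneSpectrum (𝓞 F)) {p : ℕ}
    (hp : p.Prime) (hpw : (p : 𝓞 F) ∈ w.asIdeal) :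
    0 < w.valuation F (p : F) ∧ w.valuation F (p : F) < 1 := by
  refine ⟨?_, ?_⟩
  · exact (Valuation.pos_iff _).mpr (by exact_mod_cast hp.ne_zero)
  · have : (p : F) = algebraMap (𝓞 F) F (p : 𝓞 F) := by simp
    rw [this, HeightOneSpectrum.valuation_lt_one_iff_mem]
    exact hpw

/-- **The `p`-adic valuation of the minimal discriminant read at a place `w ∣ p` of a finite
extension**: for a globally minimal `W/ℚ`, `w(Δ_min(W)) = w(p)^{ord_p Δ_min(W)}`. [folklore] -/
private theorem valuation_Δ_eq_pow_padicValInt_minimalDiscriminantInt (W : WeierstrassCurve ℚ)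
    [W.IsElliptic] [W.IsGloballyMinimal] (w : HeightOneSpectrum (𝓞 F)) {p : ℕ} (hp : p.Prime)
    (hpw : (p : 𝓞 F) ∈ w.asIdeal) :
    w.valuation F (W.Δ : F) =
      w.valuation F (p : F) ^ padicValInt p W.minimalDiscriminantInt := by
  have hΔ : (W.minimalDiscriminantInt : ℚ) = W.Δ := W.cast_minimalDiscriminantInt
  have hΔ0 : W.minimalDiscriminantInt ≠ 0 := W.minimalDiscriminantInt_ne_zero
  have hq : (W.Δ : ℚ) ≠ 0 := by rw [← hΔ]; exact_mod_cast hΔ0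
  refine valuation_ratCast_eq_pow_of_padicValRat_eq_nat w hp hpw hq ?_
  rw [← hΔ, padicValRat.of_int]

end Valuation

/-! ## Potential good reduction: a good-reduction field above `p`, and isogeny invariance -/

section GoodReductionField

open Literature.NumberTheory.GaloisRepresentations

/-- **`0 ≤ ord_p j(W)` ⟹ good reduction at some place above `p` of some number field**
(Silverman *AEC* VII.5.5, direction "`j` integral ⟹ potential good reduction", in the tree's
currency). The field is `ℚ(W[3])` (`ℚ(W[4])` when `p = 3`), over which the inertia at `p` acts
trivially on `W[3]` (`W[4]`), so that *ATAEC* IV.10.3 applies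
(`hasGoodReductionAt_baseChange_of_forall_smul_geomTorsion_three_eq`,
`exists_isGalois_hasGoodReductionAt_baseChange_of_valuation_j_le_one_of_notMem_two`); the place
`w` is any place above `p`. The block is verbatim the one inside the sibling discharge
`dokchitser_padicValInt_minimalDiscriminantInt_eq_of_isogeny_of_not_dvd_degree_holds`, exported.
[cite: SilvermanAEC2009, Prop. VII.5.5 (⇐) with ATAEC IV.10.3] -/
theorem exists_hasGoodReductionAt_baseChange_of_padicValRat_j_nonneg (W : WeierstrassCurve ℚ)
    [W.IsElliptic] {p : ℕ} (hp : p.Prime) (hj : 0 ≤ padicValRat p W.j) :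
    ∃ (F : IntermediateField ℚ (AlgebraicClosure ℚ)) (_ : FiniteDimensional ℚ F)
      (_ : NumberField F) (w : HeightOneSpectrum (𝓞 F)),
      (p : 𝓞 F) ∈ w.asIdeal ∧ (W.baseChange F).HasGoodReductionAt w := by
  classical
  haveI := Fact.mk hp
  -- the place of `ℚ` above `p` and `ord_v j ≥ 0`
  set v₀ : HeightOneSpectrum (𝓞 ℚ) := (Rat.HeightOneSpectrum.primesEquiv (R := 𝓞 ℚ)).symm ⟨p, hp⟩
    with hv₀
  have hpv₀ : (p : 𝓞 ℚ) ∈ v₀.asIdeal :=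
    (natCast_mem_asIdeal_iff_eq_primesEquiv_symm v₀ hp).mpr hv₀
  have hqv₀ : ∀ {q : ℕ}, q.Prime → q ≠ p → (q : 𝓞 ℚ) ∉ v₀.asIdeal := by
    intro q hq hqp hmem
    have h := (natCast_mem_asIdeal_iff_eq_primesEquiv_symm v₀ hq).mp hmem
    rw [hv₀, Equiv.apply_eq_iff_eq] at h
    exact hqp (congrArg (fun x : Nat.Primes ↦ (x : ℕ)) h).symm
  have hjv : v₀.valuation ℚ W.j ≤ 1 := by
    by_cases hj0 : W.j = 0
    · rw [hj0, map_zero]; exact zero_le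
    · obtain ⟨m, hm⟩ := Int.eq_ofNat_of_zero_le hj
      have h := valuation_ratCast_eq_pow_of_padicValRat_eq_nat (F := ℚ) v₀ hp hpv₀ hj0 hm
      rw [Rat.cast_id] at h
      rw [h]
      exact pow_le_one₀ zero_le (valuation_natCast_pos_and_lt_one v₀ hp hpv₀).2.le
  -- a finite Galois `F/ℚ` over which `W` has good reduction above `p`
  obtain ⟨F, hfin, hgal, hnf, hgood⟩ : ∃ (F : IntermediateField ℚ (AlgebraicClosure ℚ))
      (_ : FiniteDimensional ℚ F) (_ : IsGalois ℚ F) (_ : NumberField F),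
      ∀ w : HeightOneSpectrum (𝓞 F), w.asIdeal.under (𝓞 ℚ) = v₀.asIdeal →
        (W.baseChange F).HasGoodReductionAt w := by
    by_cases h3 : p = 3
    · have h2 : (2 : 𝓞 ℚ) ∉ v₀.asIdeal := by
        simpa using hqv₀ Nat.prime_two (by rw [h3]; decide)
      exact W.exists_isGalois_hasGoodReductionAt_baseChange_of_valuation_j_le_one_of_notMem_two
        v₀ hjv h2
    · have h3' : (3 : 𝓞 ℚ) ∉ v₀.asIdeal := by
        simpa using hqv₀ Nat.prime_three (fun h ↦ h3 h.symm)
      obtain ⟨F, hfin, hgal, hF⟩ := W.exists_isGalois_forall_smul_geomTorsion_eq (m := 3)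
        three_ne_zero
      haveI := hfin
      haveI := hgal
      haveI : NumberField F := NumberField.of_module_finite ℚ F
      exact ⟨F, hfin, hgal, inferInstance, fun w hw ↦
        W.hasGoodReductionAt_baseChange_of_forall_smul_geomTorsion_three_eq F hF h3' hjv hw⟩
  haveI := hfin
  haveI := hgal
  haveI := hnf
  -- a place `w ∣ v₀` of `F`
  obtain ⟨𝔓, h𝔓⟩ := v₀.primesAbove_nonempty
  obtain ⟨w, -, hw, -, -⟩ := exists_primesAbove_mem_inertia_iff ℚ F h𝔓
  have hpw : (p : 𝓞 F) ∈ w.asIdeal := by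
    have : (p : 𝓞 F) = algebraMap (𝓞 ℚ) (𝓞 F) p := by simp
    rw [this, ← Ideal.mem_comap, ← Ideal.under_def, hw]
    exact hpv₀
  exact ⟨F, hfin, hnf, w, hpw, hgood w hw⟩

/-- **Potential good reduction at `p` is an isogeny invariant** (Silverman *AEC* VII.7.2 with
VII.5.5): for a `ℚ`-isogeny `φ : W → W'` of elliptic curves and `0 ≤ ord_p j(W)`, also
`0 ≤ ord_p j(W')`. Over the field of
`exists_hasGoodReductionAt_baseChange_of_padicValRat_j_nonneg` the curve `W'` has good reduction
at `w` too (`Isogeny.hasGoodReductionAt_of_hasGoodReductionAt` for the dual isogeny), and good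
reduction above `p` forces `ord_p j ≥ 0` (`padicValRat_j_nonneg_of_hasGoodReductionAt_baseChange`).
[cite: SilvermanAEC2009, Cor. VII.7.2 and Prop. VII.5.5] -/
theorem padicValRat_j_nonneg_of_isogeny {W W' : WeierstrassCurve ℚ} [W.IsElliptic]
    [W'.IsElliptic] (φ : Isogeny W W') {p : ℕ} (hp : p.Prime) (hj : 0 ≤ padicValRat p W.j) :
    0 ≤ padicValRat p W'.j := by
  classical
  obtain ⟨F, hfin, hnf, w, hpw, hgW⟩ :=
    exists_hasGoodReductionAt_baseChange_of_padicValRat_j_nonneg W hp hj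
  haveI := hfin
  haveI := hnf
  haveI : (W.baseChange F).IsElliptic := inferInstanceAs (W.map (algebraMap ℚ F)).IsElliptic
  haveI : (W'.baseChange F).IsElliptic := inferInstanceAs (W'.map (algebraMap ℚ F)).IsElliptic
  obtain ⟨ψ, -⟩ := φ.exists_dual_of_isElliptic
  have hgW' : (W'.baseChange F).HasGoodReductionAt w :=
    (ψ.extendScalars F).hasGoodReductionAt_of_hasGoodReductionAt hgW
  exact W'.padicValRat_j_nonneg_of_hasGoodReductionAt_baseChange p hp w hpw hgW'

end GoodReductionField

/-! ## The one-sided kernel: a `Δ_min`-drop forces `p ∣` multiplier -/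

section OneSided

open Literature.NumberTheory.GaloisRepresentations

/-- **A `Δ_min`-drop forces `p` to divide the multiplier** (Gealy–Klagsbrun 2017, Prop. 2.1 (i)
over the good-reduction field with Cor. 3.2; the contrapositive, for an explicit multiplier, of the
sibling `padicValInt_minimalDiscriminantInt_le_of_isogeny_of_isMinimalAt`). Let `φ : W → W'` be a
`ℚ`-isogeny between globally minimal elliptic curves whose `x`-coordinate is `A/B` off `ker φ`
with `B` monic, `deg A = deg B + 1`, `lc A = k⁻²` for an integer `k ≠ 0` (the analytic multiplier:
`φ^*ω' = ±k·ω` on Néron differentials); let `F/ℚ` be finite (inside `ℚ̄`), `w ∣ p` a place of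
`F`, and `C • W_F`, `C' • W'_F` models MINIMAL at `w` with `w`-UNIT discriminants. If
`ord_p Δ_min(W') < ord_p Δ_min(W)` then `p ∣ k`. Proof: the multiplier `k u'/u` of the transported
isogeny is `w`-integral (`valuation_multiplier_le_one`), `w(Δ_W) = w(u)¹²`,
`w(Δ_{W'}) = w(u')¹²`; were `p ∤ k`, `w(k) = 1` would give `w(u') ≤ w(u)`, i.e.
`ord_p Δ_min(W) ≤ ord_p Δ_min(W')`.
[cite: GealyKlagsbrun2017, Prop. 2.1 (i) and Cor. 3.2 with the displayed equation in the proof of Thm. 2 (arXiv:1703.02148 p. 6)]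
[cite: SilvermanATAEC1994, IV.5.1 with IV.6.1 and Cor. IV.9.1] -/
theorem dvd_multiplier_of_padicValInt_minimalDiscriminantInt_lt_of_isMinimalAt
    {W W' : WeierstrassCurve ℚ} [W.IsElliptic] [W'.IsElliptic] [W.IsGloballyMinimal]
    [W'.IsGloballyMinimal] (φ : Isogeny W W') {p : ℕ} (hp : p.Prime) {k : ℤ} (hk0 : k ≠ 0)
    {A B : ℚ[X]} (hBm : B.Monic) (hdeg : A.natDegree = B.natDegree + 1)
    (hlc : A.leadingCoeff = ((k : ℚ))⁻¹ ^ 2)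
    (hform : ∀ (x y : AlgebraicClosure ℚ)
      (h : (W.baseChange (AlgebraicClosure ℚ)).toAffine.Nonsingular x y),
      φ (Affine.Point.some x y h) ≠ 0 →
      aeval x B ≠ 0 ∧ ∃ (y₂ : AlgebraicClosure ℚ)
        (h₂ : (W'.baseChange (AlgebraicClosure ℚ)).toAffine.Nonsingular (aeval x A / aeval x B) y₂),
        φ (Affine.Point.some x y h) = Affine.Point.some (aeval x A / aeval x B) y₂ h₂)
    (F : IntermediateField ℚ (AlgebraicClosure ℚ)) [FiniteDimensional ℚ F] [NumberField F]
    (w : HeightOneSpectrum (𝓞 F)) (hpw : (p : 𝓞 F) ∈ w.asIdeal) (C C' : VariableChange F)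
    (hC : (C • W.baseChange F).IsMinimalAt w) (hC' : (C' • W'.baseChange F).IsMinimalAt w)
    (hΔ : w.valuation F (C • W.baseChange F).Δ = 1)
    (hΔ' : w.valuation F (C' • W'.baseChange F).Δ = 1)
    (hlt : padicValInt p W'.minimalDiscriminantInt < padicValInt p W.minimalDiscriminantInt) :
    (p : ℤ) ∣ k := by
  classical
  haveI := Fact.mk hp
  by_contra hpk
  haveI : (W.baseChange F).IsElliptic := inferInstanceAs (W.map (algebraMap ℚ F)).IsElliptic
  haveI : (W'.baseChange F).IsElliptic := inferInstanceAs (W'.map (algebraMap ℚ F)).IsElliptic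
  have hwk : w.valuation F ((k : ℚ) : F) = 1 := by
    refine valuation_ratCast_eq_one_of_padicValRat_eq_zero (v := w) hp hpw
      (by exact_mod_cast hk0) ?_
    rw [padicValRat.of_int, padicValInt.eq_zero_of_not_dvd hpk, Nat.cast_zero]
  -- the transported isogeny between the minimal models and its multiplier
  obtain ⟨Φ, A', B', Bad, hBad, hB'm, hdeg', hlc', hform'⟩ :=
    φ.exists_x_formula_smul_extendScalars hBm hdeg hlc hform F C C'
  haveI : ((C • W.baseChange F).baseChange (w.adicCompletion F)).IsMinimal
      (w.adicCompletionIntegers F) := hC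
  haveI : ((C' • W'.baseChange F).baseChange (w.adicCompletion F)).IsMinimal
      (w.adicCompletionIntegers F) := hC'
  set c : F := algebraMap ℚ F k * (C'.u : F) * (C.u : F)⁻¹ with hc
  have hkF : algebraMap ℚ F (k : ℚ) = ((k : ℚ) : F) := by rw [eq_ratCast]
  have hkF0 : algebraMap ℚ F (k : ℚ) ≠ 0 := by
    rw [hkF]; exact_mod_cast hk0
  have hc0 : c ≠ 0 := mul_ne_zero (mul_ne_zero hkF0 C'.u.ne_zero) (inv_ne_zero C.u.ne_zero)
  have hval : w.valuation F c ≤ 1 :=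
    HeightOneSpectrum.valuation_multiplier_le_one w (C • W.baseChange F) (C' • W'.baseChange F)
      Φ hc0 hBad hB'm hdeg' hlc' hform'
  -- `w(u') ≤ w(u)`
  have hu0 : w.valuation F (C.u : F) ≠ 0 := (Valuation.ne_zero_iff _).mpr C.u.ne_zero
  have hu'le : w.valuation F (C'.u : F) ≤ w.valuation F (C.u : F) := by
    rw [hc, map_mul, map_mul, map_inv₀, hkF, hwk, one_mul] at hval
    rwa [mul_inv_le_iff₀ (zero_lt_iff.mpr hu0), one_mul] at hval
  -- `w(Δ_W) = w(u)¹²`, `w(Δ_{W'}) = w(u')¹²`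
  have hΔu : ∀ (V : WeierstrassCurve ℚ) (D : VariableChange F),
      w.valuation F (D • V.baseChange F).Δ = 1 →
      w.valuation F (V.Δ : F) = w.valuation F (D.u : F) ^ 12 := by
    intro V D h
    have hD0 : w.valuation F (D.u : F) ≠ 0 := (Valuation.ne_zero_iff _).mpr D.u.ne_zero
    rw [variableChange_Δ, WeierstrassCurve.baseChange, map_Δ, eq_ratCast, map_mul, map_pow,
      Units.val_inv_eq_inv_val, map_inv₀] at h
    rwa [inv_pow, inv_mul_eq_one₀ (pow_ne_zero _ hD0), eq_comm] at h
  have h1 : w.valuation F (W'.Δ : F) ≤ w.valuation F (W.Δ : F) := by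
    rw [hΔu W C hΔ, hΔu W' C' hΔ']
    exact pow_le_pow_left₀ zero_le hu'le 12
  -- translate to `ord_p`
  rw [valuation_Δ_eq_pow_padicValInt_minimalDiscriminantInt W w hp hpw,
    valuation_Δ_eq_pow_padicValInt_minimalDiscriminantInt W' w hp hpw] at h1
  obtain ⟨hp0, hp1⟩ := valuation_natCast_pos_and_lt_one w hp hpw
  rw [pow_le_pow_iff_right_of_lt_one₀ hp0 hp1] at h1
  exact absurd h1 (not_le.mpr hlt)

end OneSided

/-! ## The lattice form: the direction of the Néron scaling -/

section Lattice

open Literature.NumberTheory.GaloisRepresentations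

/-- **A `Δ_min`-DROP along a rational isogeny forces `p ∣` Néron scaling** (Gealy–Klagsbrun 2017,
Prop. 2.1 (i) + Cor. 3.2, read at `K = ℚ_p` between globally minimal models; Dokchitser–Dokchitser
2015, Table 1, the rule behind the column `φ^*ω'/ω`). Let `W, W'/ℚ` be globally minimal elliptic
curves with Néron period pairs `L, L'` (`IsNeronLatticeOf`), `α ∈ ℤ` with `αΛ_W ⊆ Λ_{W'}` — so
`z ↦ αz : ℂ/Λ_W → ℂ/Λ_{W'}` is a `ℚ`-isogeny (of ANY degree) pulling the Néron differential of `W'`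
back to `α` times that of `W` — and `W` potentially good at `p` (`0 ≤ ord_p j(W)`). If
`ord_p Δ_min(W') < ord_p Δ_min(W)` then `p ∣ α`. In particular `ord_p Δ_min` never drops along an
isogeny of degree prime to `p` (the sibling's Thm. 5.1 (1)). Proof: the isogeny with its analytic
description (`exists_isogeny_baseChange_apply_eq_of_forall_mul_mem_lattice`) has `x`-coordinate
with `lc = α⁻²` (`Isogeny.exists_x_formula_of_baseChange_apply_eq`); take the good-reduction field
and place of `exists_hasGoodReductionAt_baseChange_of_padicValRat_j_nonneg`, good reduction of `W'`
there by the dual isogeny (*AEC* VII.7.2), `w`-minimal `F`-models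
(`exists_variableChange_isMinimalAt_dedekind`), and apply
`dvd_multiplier_of_padicValInt_minimalDiscriminantInt_lt_of_isMinimalAt`.
[cite: GealyKlagsbrun2017, Prop. 2.1 (i), Cor. 3.2 and proof of Thm. 2 (arXiv:1703.02148 pp. 5–6)]
[cite: DokchitserDokchitser2015LocalInvariants, Table 1 (arXiv:1208.5519 p. 3) with §4 Lemma 10 (1) and Lemma 12 (p. 7)] -/
theorem dvd_neronScaling_of_padicValInt_minimalDiscriminantInt_lt
    (W W' : WeierstrassCurve ℚ) [W.IsElliptic] [W'.IsElliptic] [W.IsGloballyMinimal]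
    [W'.IsGloballyMinimal] {p : ℕ} (hp : p.Prime) (L L' : PeriodPair)
    (hL : IsNeronLatticeOf (W.baseChange ℂ) L) (hL' : IsNeronLatticeOf (W'.baseChange ℂ) L')
    (α : ℤ) (hα : ∀ z ∈ L.lattice, (α : ℂ) * z ∈ L'.lattice) (hj : 0 ≤ padicValRat p W.j)
    (hlt : padicValInt p W'.minimalDiscriminantInt < padicValInt p W.minimalDiscriminantInt) :
    (p : ℤ) ∣ α := by
  classical
  haveI := Fact.mk hp
  rcases eq_or_ne α 0 with rfl | hα0
  · exact dvd_zero _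
  -- an embedding `ℚ̄ → ℂ`
  haveI hQbar : Algebra.IsAlgebraic ℚ (AlgebraicClosure ℚ) := AlgebraicClosure.isAlgebraic ℚ
  letI : Algebra (AlgebraicClosure ℚ) ℂ :=
    (IsAlgClosed.lift : AlgebraicClosure ℚ →ₐ[ℚ] ℂ).toRingHom.toAlgebra
  haveI : IsScalarTower ℚ (AlgebraicClosure ℚ) ℂ :=
    IsScalarTower.of_algebraMap_eq' (Subsingleton.elim _ _)
  haveI hWC : (W.baseChange ℂ).IsElliptic := by
    rw [WeierstrassCurve.baseChange]; infer_instance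
  haveI hWC' : (W'.baseChange ℂ).IsElliptic := by
    rw [WeierstrassCurve.baseChange]; infer_instance
  obtain ⟨h₂, h₃⟩ := hL
  obtain ⟨h₂', h₃'⟩ := hL'
  -- uniformisations `u : ℂ/Λ ≅ W(ℂ)`, `u' : ℂ/Λ' ≅ W'(ℂ)`
  obtain ⟨u, hkeru, hsurj, hu⟩ := L.exists_addMonoidHom_of_g₂_g₃' h₂ h₃
  obtain ⟨u', hkeru', -, hu'⟩ := L'.exists_addMonoidHom_of_g₂_g₃' h₂' h₃'
  -- the `ℚ`-isogeny `z ↦ αz`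
  have hαQ0 : (α : ℚ) ≠ 0 := by exact_mod_cast hα0
  have hαQC : ((α : ℚ) : ℂ) = (α : ℂ) := Rat.cast_intCast α
  have hle : ∀ z ∈ L.lattice, ((α : ℚ) : ℂ) * z ∈ L'.lattice := fun z hz ↦ by
    rw [hαQC]; exact hα z hz
  obtain ⟨φ, happ, -, -⟩ := exists_isogeny_baseChange_apply_eq_of_forall_mul_mem_lattice
    h₂ h₃ h₂' h₃' hkeru hsurj hu hkeru' hu' hαQ0 hle
  -- its `x`-coordinate, with leading coefficient `α⁻²`
  have hleA : ∀ z ∈ L.lattice, algebraMap ℚ ℂ (α : ℚ) * z ∈ L'.lattice := fun z hz ↦ by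
    rw [eq_ratCast]; exact hle z hz
  have happA : ∀ z, φ.baseChange (u z) = u' (algebraMap ℚ ℂ (α : ℚ) * z) := fun z ↦ by
    rw [eq_ratCast]; exact happ z
  obtain ⟨A, B, hBm, hdegAB, hlc, hform⟩ :=
    φ.exists_x_formula_of_baseChange_apply_eq h₂ h₃ h₂' h₃' hsurj hu hkeru' hu' hαQ0 hleA happA
  -- a number field and a place `w ∣ p` where `W`, hence `W'`, has good reduction
  obtain ⟨F, hfin, hnf, w, hpw, hgW⟩ :=
    exists_hasGoodReductionAt_baseChange_of_padicValRat_j_nonneg W hp hj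
  haveI := hfin
  haveI := hnf
  haveI : (W.baseChange F).IsElliptic := inferInstanceAs (W.map (algebraMap ℚ F)).IsElliptic
  haveI : (W'.baseChange F).IsElliptic := inferInstanceAs (W'.map (algebraMap ℚ F)).IsElliptic
  obtain ⟨ψ, -⟩ := φ.exists_dual_of_isElliptic
  have hgW' : (W'.baseChange F).HasGoodReductionAt w :=
    (ψ.extendScalars F).hasGoodReductionAt_of_hasGoodReductionAt hgW
  -- minimal models at `w`, with unit discriminants
  obtain ⟨C, hC⟩ := exists_variableChange_isMinimalAt_dedekind (W.baseChange F) w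
  obtain ⟨C', hC'⟩ := exists_variableChange_isMinimalAt_dedekind (W'.baseChange F) w
  have hΔ : w.valuation F (C • W.baseChange F).Δ = 1 :=
    (hasGoodReductionAt_iff_of_isMinimalAt hC).mp
      ((hasGoodReductionAt_smul_iff_holds w (W.baseChange F) C).mpr hgW)
  have hΔ' : w.valuation F (C' • W'.baseChange F).Δ = 1 :=
    (hasGoodReductionAt_iff_of_isMinimalAt hC').mp
      ((hasGoodReductionAt_smul_iff_holds w (W'.baseChange F) C').mpr hgW')
  exact dvd_multiplier_of_padicValInt_minimalDiscriminantInt_lt_of_isMinimalAt φ hp hα0 hBm hdegAB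
    hlc hform F w hpw C C' hC hC' hΔ hΔ' hlt

/-- **The direction of the Néron scaling of a `p`-isogeny that moves `ord_p Δ_min`** — clauses
(2) and (3) of Gealy–Klagsbrun 2017, Thm. 1 at `K = ℚ_p`, for EVERY reduction type
(Dokchitser–Dokchitser 2015, Table 1: which of "`1` or `p`"). Let `W, W'/ℚ` be globally minimal
with Néron period pairs `L, L'`, `α ∈ ℤ` with `αΛ_W ⊆ Λ_{W'}` of index `p`
(`[Λ_{W'} : αΛ_W] = p`, Mathlib `AddSubgroup.relIndex`; `z ↦ αz` is a `p`-isogeny with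
`φ^*ω_{W'} = α·ω_W`), and `0 ≤ ord_p j(W)`. Then
`ord_p Δ_min(W') < ord_p Δ_min(W) ⇒ p ∥ α` (`α_φ = p`) and
`ord_p Δ_min(W) < ord_p Δ_min(W') ⇒ p ∤ α` (`α_φ = 1`). Proof: the drop clause is
`dvd_neronScaling_of_padicValInt_minimalDiscriminantInt_lt` plus `α ∣ p`
(`exists_int_eq_and_dvd_of_neronScaling`); for the rise clause the dual scalar `β = p/α ∈ ℤ`
has `βΛ_{W'} ⊆ Λ_W` (from the index) and `W'` is potentially good at `p`
(`padicValRat_j_nonneg_of_isogeny`), so the drop clause for `W' → W` gives `p ∣ β`, and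
`αβ = p` (Gealy–Klagsbrun Prop. 2.1 (ii) = Dokchitser–Dokchitser, proof of Lemma 11: `aa′ = p`)
leaves `α = ±1`. NOT proved here: clause (1) of op. cit. Thm. 1 (`ord_p Δ_min(W) ≠ ord_p Δ_min(W')`
at an additive potentially supersingular `p`), which needs the inseparability of `φ` and `φ'`
modulo `𝔭` (op. cit. Prop. 2.6).
[cite: GealyKlagsbrun2017, Thm. 1 clauses "1 if v_min(E/K) < v_min(E′/K), p^{deg K} if v_min(E/K) > v_min(E′/K)" (arXiv:1703.02148 p. 3) via Prop. 2.1, Cor. 2.2, Cor. 3.2 and the proof of Thm. 2 (pp. 5–6)]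
[cite: DokchitserDokchitser2015LocalInvariants, Table 1 rows l = p (arXiv:1208.5519 p. 3 L71–73) with §4 Lemma 10 (1) and proof of Lemma 11 "aa′ = p" (p. 7 L45)] -/
theorem dvd_and_not_dvd_neronScaling_of_padicValInt_minimalDiscriminantInt_lt_of_relIndex_eq
    (W W' : WeierstrassCurve ℚ) [W.IsElliptic] [W'.IsElliptic] [W.IsGloballyMinimal]
    [W'.IsGloballyMinimal] (p : ℕ) [Fact p.Prime] (L L' : PeriodPair) (α : ℤ)
    (hL : IsNeronLatticeOf (W.baseChange ℂ) L) (hL' : IsNeronLatticeOf (W'.baseChange ℂ) L')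
    (hα : ∀ z ∈ L.lattice, (α : ℂ) * z ∈ L'.lattice)
    (hidx : (L.lattice.toAddSubgroup.map (AddMonoidHom.mulLeft (α : ℂ))).relIndex
      L'.lattice.toAddSubgroup = p)
    (hj : 0 ≤ padicValRat p W.j) :
    (padicValInt p W'.minimalDiscriminantInt < padicValInt p W.minimalDiscriminantInt →
        (p : ℤ) ∣ α ∧ ¬ (p : ℤ) ^ 2 ∣ α) ∧
      (padicValInt p W.minimalDiscriminantInt < padicValInt p W'.minimalDiscriminantInt →
        ¬ (p : ℤ) ∣ α) := by
  classical
  have hp : p.Prime := Fact.out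
  have hp0 : ((p : ℕ) : ℤ) ≠ 0 := by exact_mod_cast hp.ne_zero
  -- `pΛ' ⊆ αΛ` from the index
  have hpα : ∀ z ∈ L'.lattice, ∃ y ∈ L.lattice, (p : ℂ) * z = (α : ℂ) * y := by
    intro z hz
    have h := AddSubgroup.nsmul_relIndex_mem
      (L.lattice.toAddSubgroup.map (AddMonoidHom.mulLeft (α : ℂ))) (K := L'.lattice.toAddSubgroup)
      (show z ∈ L'.lattice.toAddSubgroup from hz)
    rw [hidx, AddSubgroup.mem_map] at h
    obtain ⟨y, hy, hyz⟩ := h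
    have hyz' : (α : ℂ) * y = p • z := hyz
    refine ⟨y, hy, ?_⟩
    rw [hyz', nsmul_eq_mul]
  -- `α ∣ p`
  obtain ⟨k, hk, hkp⟩ := exists_int_eq_and_dvd_of_neronScaling W W' L L' hL hL' (α : ℚ) hp0
    (by simpa using hα) (by simpa using hpα)
  have hkα : k = α := by exact_mod_cast hk
  rw [hkα] at hkp
  have hα0 : α ≠ 0 := by
    rintro rfl
    exact hp.ne_zero (by exact_mod_cast (zero_dvd_iff.mp hkp))
  refine ⟨fun hlt ↦ ⟨dvd_neronScaling_of_padicValInt_minimalDiscriminantInt_lt W W' hp L L' hL hL'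
    α hα hj hlt, fun hsq ↦ ?_⟩, fun hlt hdvd ↦ ?_⟩
  · -- `p² ∣ α ∣ p` is impossible
    have : ((p : ℤ) ^ 2) ∣ (p : ℤ) := dvd_trans hsq hkp
    have h1 : (p : ℤ) ^ 2 ≤ (p : ℤ) := Int.le_of_dvd (by exact_mod_cast hp.pos) this
    have h2 : (2 : ℤ) ≤ p := by exact_mod_cast hp.two_le
    nlinarith
  · -- the rise clause: the dual scalar `β = p/α`
    obtain ⟨β, hβ⟩ := hkp
    have hαC : (α : ℂ) ≠ 0 := by exact_mod_cast hα0
    have hβΛ : ∀ z ∈ L'.lattice, (β : ℂ) * z ∈ L.lattice := by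
      intro z hz
      obtain ⟨y, hy, hyz⟩ := hpα z hz
      have hpC : (p : ℂ) = (α : ℂ) * (β : ℂ) := by
        rw [← Int.cast_natCast (R := ℂ) p, hβ]; push_cast; ring
      have : (β : ℂ) * z = y := by
        apply mul_left_cancel₀ hαC
        rw [← mul_assoc, ← hpC, hyz]
      rw [this]; exact hy
    -- `W'` is potentially good at `p`: through the isogeny `z ↦ αz`
    have hj' : 0 ≤ padicValRat p W'.j := by
      haveI hQbar : Algebra.IsAlgebraic ℚ (AlgebraicClosure ℚ) := AlgebraicClosure.isAlgebraic ℚ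
      letI : Algebra (AlgebraicClosure ℚ) ℂ :=
        (IsAlgClosed.lift : AlgebraicClosure ℚ →ₐ[ℚ] ℂ).toRingHom.toAlgebra
      haveI : IsScalarTower ℚ (AlgebraicClosure ℚ) ℂ :=
        IsScalarTower.of_algebraMap_eq' (Subsingleton.elim _ _)
      haveI hWC : (W.baseChange ℂ).IsElliptic := by
        rw [WeierstrassCurve.baseChange]; infer_instance
      haveI hWC' : (W'.baseChange ℂ).IsElliptic := by
        rw [WeierstrassCurve.baseChange]; infer_instance
      obtain ⟨h₂, h₃⟩ := hL
      obtain ⟨h₂', h₃'⟩ := hL'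
      obtain ⟨u, hkeru, hsurj, hu⟩ := L.exists_addMonoidHom_of_g₂_g₃' h₂ h₃
      obtain ⟨u', hkeru', -, hu'⟩ := L'.exists_addMonoidHom_of_g₂_g₃' h₂' h₃'
      have hαQ0 : (α : ℚ) ≠ 0 := by exact_mod_cast hα0
      have hle : ∀ z ∈ L.lattice, ((α : ℚ) : ℂ) * z ∈ L'.lattice := fun z hz ↦ by
        rw [Rat.cast_intCast]; exact hα z hz
      obtain ⟨φ, -, -, -⟩ := exists_isogeny_baseChange_apply_eq_of_forall_mul_mem_lattice
        h₂ h₃ h₂' h₃' hkeru hsurj hu hkeru' hu' hαQ0 hle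
      exact padicValRat_j_nonneg_of_isogeny φ hp hj
    -- the drop clause for `W' → W`, scalar `β`
    have hpβ : (p : ℤ) ∣ β :=
      dvd_neronScaling_of_padicValInt_minimalDiscriminantInt_lt W' W hp L' L hL' hL β hβΛ hj' hlt
    -- `αβ = p` with `p ∣ α` and `p ∣ β`: then `p² ∣ p`
    obtain ⟨m, hm⟩ := hdvd
    obtain ⟨n, hn⟩ := hpβ
    have hpp : (p : ℤ) * (p * (m * n)) = p * 1 := by
      rw [mul_one]
      calc (p : ℤ) * (p * (m * n)) = (p * m) * (p * n) := by ring
        _ = α * β := by rw [hm, hn]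
        _ = p := hβ.symm
    have hmn : (p : ℤ) * (m * n) = 1 := mul_left_cancel₀ hp0 hpp
    have hpu : (p : ℤ) ∣ 1 := ⟨m * n, hmn.symm⟩
    exact hp.one_lt.ne' (by exact_mod_cast Int.eq_one_of_dvd_one (by positivity) hpu)

/-- **Gealy–Klagsbrun 2017, Thm. 1 (`K = ℚ_p`) REDUCES to its clause (1).** The tree's named fact
`gealyKlagsbrun2017_neronScalar_of_additive_potSupersingular` follows from the bare statement
"a `p`-isogeny out of a curve with additive, potentially supersingular reduction at `p` changes
`ord_p Δ_min`" (op. cit. Thm. 1, first clause; its proof is Prop. 2.6: supersingular `⇒` `φ` and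
`φ'` both inseparable mod `𝔭` — not in the tree), the directional clauses being
`dvd_and_not_dvd_neronScaling_of_padicValInt_minimalDiscriminantInt_lt_of_relIndex_eq`. No new
fact is introduced: the hypothesis is spelled out inline, with exactly the binders of the fact.
[cite: GealyKlagsbrun2017, Thm. 1 (arXiv:1703.02148 p. 3) and Prop. 2.6 (p. 5)] -/
theorem gealyKlagsbrun2017_neronScalar_of_additive_potSupersingular_of_ne
    (hne : ∀ (W W₂ : WeierstrassCurve ℚ) [W.IsElliptic] [W.IsGloballyMinimal] [W₂.IsElliptic]
      [W₂.IsGloballyMinimal] (p : ℕ) [Fact p.Prime] (L L₂ : PeriodPair) (α : ℤ),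
      IsNeronLatticeOf (W.baseChange ℂ) L → IsNeronLatticeOf (W₂.baseChange ℂ) L₂ →
      (∀ z ∈ L.lattice, (α : ℂ) * z ∈ L₂.lattice) →
      (L.lattice.toAddSubgroup.map (AddMonoidHom.mulLeft (α : ℂ))).relIndex
        L₂.lattice.toAddSubgroup = p →
      ¬ W.HasGoodReductionAtPrime p → ¬ W.HasMultiplicativeReductionAtPrime p →
      0 ≤ padicValRat p W.j → ¬ W.HasPotentiallyGoodOrdinaryReductionAtPrime p →
      padicValInt p W.minimalDiscriminantInt ≠ padicValInt p W₂.minimalDiscriminantInt) :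
    gealyKlagsbrun2017_neronScalar_of_additive_potSupersingular := by
  intro W W₂ _ _ _ _ p _ L L₂ α hL hL₂ hα hidx hgood hmult hj hpo
  obtain ⟨hdrop, hrise⟩ :=
    dvd_and_not_dvd_neronScaling_of_padicValInt_minimalDiscriminantInt_lt_of_relIndex_eq W W₂ p L
      L₂ α hL hL₂ hα hidx hj
  exact ⟨hne W W₂ p L L₂ α hL hL₂ hα hidx hgood hmult hj hpo, hrise, hdrop⟩

end Lattice

end Literature.NumberTheory.EllipticCurves

end
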